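import Mathlib
import Summits.ValiantsHypothesis.ValiantsHypothesis.Theorems.ElementaryWordLengthWordLengthQPStubKappaTwoStructureAux
import Summits.ValiantsHypothesis.ValiantsHypothesis.Theorems.ElementaryWordLengthWordLengthQPStubKappaTwoStructureAuxB
import Summits.ValiantsHypothesis.ValiantsHypothesis.Theorems.ElementaryWordLengthWordLengthQPStubKappaTwoStructureAuxC
import Summits.ValiantsHypothesis.ValiantsHypothesis.Theorems.ElementaryWordLengthWordLengthQPStubKappaTwoStructureAuxD
import Summits.ValiantsHypothesis.ValiantsHypothesis.Theorems.ElementaryWordLengthWordLengthQPStubKappaTwoStructureAuxE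

/-!
# Crux `WordLengthQP` (stmt-ValiantsHypothesis-6623), line `positive-monoid-exits` —
helpers for stub `stub_kappaTwoStructure`, part F: decomposing a two-exit word, closing
lemmas, skeleton facts.

* `k2_decomp5`: the five ways a cut `A ++ l :: B` can sit in `p₀ ++ L₁ :: (q ++ L₂ :: p₂)`;
* `k2_close_col2` / `k2_close_row0`: if no letter feeds column `2` (row `0`) then `F = 0`;
* `k2_skel_loop`: the skeleton of a word computing `E₀₂(F)` (`F` without constant term) is a
  loop; `k2_skel_inv_letter`: `E_ij(t) Y = 1 ⇒ Y = E_ij(-t)`.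
-/

set_option linter.dupNamespace false

noncomputable section

namespace Summit.ValiantsHypothesis.ValiantsHypothesis.Cruxes.WordLengthQP.PositiveMonoidExits

open MvPolynomial

/-- The five positions of a cut `A ++ l :: B` of `p₀ ++ L₁ :: (q ++ L₂ :: p₂)`. [folklore] -/
theorem k2_decomp5 {α : Type*} (p0 q p2 A B : List α) (L1 L2 l : α)
    (h : p0 ++ L1 :: (q ++ L2 :: p2) = A ++ l :: B) :
    (∃ t, p0 = A ++ l :: t) ∨ (A = p0 ∧ l = L1) ∨ (∃ s t, q = s ++ l :: t ∧ A = p0 ++ L1 :: s) ∨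
      (A = p0 ++ L1 :: q ∧ l = L2) ∨ (∃ s t, p2 = s ++ l :: t ∧ A = p0 ++ L1 :: (q ++ L2 :: s)) := by
  rcases List.append_eq_append_iff.1 h with ⟨a', hA, hr⟩ | ⟨c', hp0, hlB⟩
  · -- A = p0 ++ a',  L1 :: rest = a' ++ l :: B
    rcases List.cons_eq_append_iff.1 hr with ⟨ha', hlB⟩ | ⟨a'', ha', hrest⟩
    · subst ha'
      rw [List.append_nil] at hA
      exact Or.inr (Or.inl ⟨hA, (List.cons.inj hlB).1⟩)
    · subst ha'
      -- rest = q ++ L2 :: p2 = a'' ++ l :: B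
      rcases List.append_eq_append_iff.1 hrest with ⟨a3, ha'', hr3⟩ | ⟨c3, hq, hlB3⟩
      · rcases List.cons_eq_append_iff.1 hr3 with ⟨ha3, hlB⟩ | ⟨a4, ha3, hp2⟩
        · subst ha3
          rw [List.append_nil] at ha''
          subst ha''
          exact Or.inr (Or.inr (Or.inr (Or.inl ⟨hA, (List.cons.inj hlB).1⟩)))
        · subst ha3; subst ha''
          exact Or.inr (Or.inr (Or.inr (Or.inr ⟨a4, B, hp2, hA⟩)))
      · rcases c3 with _ | ⟨l', c4⟩
        · rw [List.append_nil] at hq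
          simp only [List.nil_append] at hlB3
          subst hq
          exact Or.inr (Or.inr (Or.inr (Or.inl ⟨hA, (List.cons.inj hlB3).1⟩)))
        · simp only [List.cons_append, List.cons.injEq] at hlB3
          obtain ⟨rfl, -⟩ := hlB3
          exact Or.inr (Or.inr (Or.inl ⟨a'', c4, hq, hA⟩))
  · -- p0 = A ++ c',  l :: B = c' ++ L1 :: rest
    rcases c' with _ | ⟨l', c''⟩
    · rw [List.append_nil] at hp0
      simp only [List.nil_append] at hlB
      exact Or.inr (Or.inl ⟨hp0.symm, (List.cons.inj hlB).1⟩)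
    · simp only [List.cons_append, List.cons.injEq] at hlB
      obtain ⟨rfl, -⟩ := hlB
      exact Or.inl ⟨c'', hp0⟩

/-- Column `2` of a valid letter whose `(·, 2)`-type coefficient vanishes is `e₂`. [folklore] -/
theorem k2_letter_col2' {σ : Type} (l : Fin 3 × Fin 3 × ℝ × Option σ)
    (h2 : l.2.1 = 2 → l.2.2.1 = 0) (i : Fin 3) : (Matrix.transvection (Prod.fst l) (Prod.fst (Prod.snd l)) (MvPolynomial.C (Prod.fst (Prod.snd (Prod.snd l))) * Option.elim (Prod.snd (Prod.snd (Prod.snd l))) 1 MvPolynomial.X) : Matrix (Fin 3) (Fin 3) (MvPolynomial σ ℝ)) i 2 = if i = 2 then 1 else 0 := by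
  by_cases hj : l.2.1 = 2
  · rw [h2 hj]; fin_cases i <;> simp
  · rw [Matrix.transvection, Matrix.add_apply, Matrix.single_apply, if_neg (fun h => hj h.2),
      add_zero, Matrix.one_apply]

/-- **Closing lemma (column `2`).** If no letter of a word computing `E₀₂(F)` feeds column `2`
(every letter of type `(·, 2)` has coefficient `0`), then `F = 0`. [folklore] -/
theorem k2_close_col2 {σ : Type} (F : MvPolynomial σ ℝ) (w : List (Fin 3 × Fin 3 × ℝ × Option σ))
    (h2 : ∀ l ∈ w, l.2.1 = 2 → l.2.2.1 = 0)
    (hF : (w.map (fun l => (Matrix.transvection (Prod.fst l) (Prod.fst (Prod.snd l)) (MvPolynomial.C (Prod.fst (Prod.snd (Prod.snd l))) * Option.elim (Prod.snd (Prod.snd (Prod.snd l))) 1 MvPolynomial.X) : Matrix (Fin 3) (Fin 3) (MvPolynomial σ ℝ)))).prod = Matrix.transvection (0 : Fin 3) 2 F) : F = 0 := by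
  have key : ∀ i, (w.map (fun l => (Matrix.transvection (Prod.fst l) (Prod.fst (Prod.snd l)) (MvPolynomial.C (Prod.fst (Prod.snd (Prod.snd l))) * Option.elim (Prod.snd (Prod.snd (Prod.snd l))) 1 MvPolynomial.X) : Matrix (Fin 3) (Fin 3) (MvPolynomial σ ℝ)))).prod i 2 = if i = 2 then 1 else 0 := by
    clear hF
    induction w with
    | nil => intro i; simp [Matrix.one_apply]
    | cons l w ih =>
      have ih' := ih (fun l' hl' => h2 l' (by simp [hl']))
      have hl := k2_letter_col2' l (h2 l (by simp))
      intro i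
      rw [List.map_cons, List.prod_cons, Matrix.mul_apply, Fin.sum_univ_three, ih', ih', ih', hl]
      simp
  have := key 0
  rw [hF] at this
  simpa [Matrix.transvection] using this

/-- Row `0` of a valid letter whose `(0, ·)`-type coefficient vanishes is `e₀`. [folklore] -/
theorem k2_letter_row0' {σ : Type} (l : Fin 3 × Fin 3 × ℝ × Option σ)
    (h0 : l.1 = 0 → l.2.2.1 = 0) (j : Fin 3) : (Matrix.transvection (Prod.fst l) (Prod.fst (Prod.snd l)) (MvPolynomial.C (Prod.fst (Prod.snd (Prod.snd l))) * Option.elim (Prod.snd (Prod.snd (Prod.snd l))) 1 MvPolynomial.X) : Matrix (Fin 3) (Fin 3) (MvPolynomial σ ℝ)) 0 j = if j = 0 then 1 else 0 := by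
  by_cases hi : l.1 = 0
  · rw [h0 hi]; fin_cases j <;> simp
  · rw [Matrix.transvection, Matrix.add_apply, Matrix.single_apply, if_neg (fun h => hi h.1),
      add_zero, Matrix.one_apply]
    simp [eq_comm]

/-- **Closing lemma (row `0`).** If no letter of a word computing `E₀₂(F)` draws from row `0`
(every letter of type `(0, ·)` has coefficient `0`), then `F = 0`. [folklore] -/
theorem k2_close_row0 {σ : Type} (F : MvPolynomial σ ℝ) (w : List (Fin 3 × Fin 3 × ℝ × Option σ))
    (h0 : ∀ l ∈ w, l.1 = 0 → l.2.2.1 = 0)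
    (hF : (w.map (fun l => (Matrix.transvection (Prod.fst l) (Prod.fst (Prod.snd l)) (MvPolynomial.C (Prod.fst (Prod.snd (Prod.snd l))) * Option.elim (Prod.snd (Prod.snd (Prod.snd l))) 1 MvPolynomial.X) : Matrix (Fin 3) (Fin 3) (MvPolynomial σ ℝ)))).prod = Matrix.transvection (0 : Fin 3) 2 F) : F = 0 := by
  have key : ∀ j, (w.map (fun l => (Matrix.transvection (Prod.fst l) (Prod.fst (Prod.snd l)) (MvPolynomial.C (Prod.fst (Prod.snd (Prod.snd l))) * Option.elim (Prod.snd (Prod.snd (Prod.snd l))) 1 MvPolynomial.X) : Matrix (Fin 3) (Fin 3) (MvPolynomial σ ℝ)))).prod 0 j = if j = 0 then 1 else 0 := by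
    clear hF
    induction w with
    | nil => intro j; simp [Matrix.one_apply, eq_comm]
    | cons l w ih =>
      have ih' := ih (fun l' hl' => h0 l' (by simp [hl']))
      have hl := k2_letter_row0' l (h0 l (by simp))
      intro j
      rw [List.map_cons, List.prod_cons, Matrix.mul_apply, Fin.sum_univ_three, hl, hl, hl, ih']
      simp
  have := key 2
  rw [hF] at this
  simpa [Matrix.transvection] using this

/-- The skeleton of a word computing `E₀₂(F)` (no constant term in `F`) is a loop. [folklore] -/
theorem k2_skel_loop {σ : Type} (F : MvPolynomial σ ℝ) (h : ∀ m ∈ F.support, 1 ≤ Finsupp.degree m)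
    (w : List (Fin 3 × Fin 3 × ℝ × Option σ))
    (hF : (w.map (fun l => (Matrix.transvection (Prod.fst l) (Prod.fst (Prod.snd l)) (MvPolynomial.C (Prod.fst (Prod.snd (Prod.snd l))) * Option.elim (Prod.snd (Prod.snd (Prod.snd l))) 1 MvPolynomial.X) : Matrix (Fin 3) (Fin 3) (MvPolynomial σ ℝ)))).prod = Matrix.transvection (0 : Fin 3) 2 F) :
    (w.map (fun l => (Matrix.transvection (Prod.fst l) (Prod.fst (Prod.snd l)) (Option.elim (Prod.snd (Prod.snd (Prod.snd l))) (Prod.fst (Prod.snd (Prod.snd l))) (fun _ => (0 : ℝ))) : Matrix (Fin 3) (Fin 3) ℝ))).prod = 1 := by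
  rw [← k2_cc_prod, hF, k2_cc_far F h]

/-- `E_ij(t) Y = 1 ⇒ Y = E_ij(-t)` and `Y E_ij(t) = 1 ⇒ Y = E_ij(-t)` (`i ≠ j`). [folklore] -/
theorem k2_skel_inv_letter (i j : Fin 3) (hij : i ≠ j) (t : ℝ) (Y : Matrix (Fin 3) (Fin 3) ℝ) :
    (Matrix.transvection i j t * Y = 1 → Y = Matrix.transvection i j (-t)) ∧
    (Y * Matrix.transvection i j t = 1 → Y = Matrix.transvection i j (-t)) := by
  constructor <;> intro h
  · have := congrArg (fun X => Matrix.transvection i j (-t) * X) h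
    simpa [← Matrix.mul_assoc, Matrix.transvection_mul_transvection_same _ _ hij] using this
  · have := congrArg (fun X => X * Matrix.transvection i j (-t)) h
    simpa [Matrix.mul_assoc, Matrix.transvection_mul_transvection_same _ _ hij] using this

/-- The skeleton of a letter is `BLK`-typed: it is `1`, or `E_ij(c)` with the letter's own type and
`o = none`. [folklore] -/
theorem k2_skel_cases {σ : Type} (l : Fin 3 × Fin 3 × ℝ × Option σ) :
    (Matrix.transvection (Prod.fst l) (Prod.fst (Prod.snd l)) (Option.elim (Prod.snd (Prod.snd (Prod.snd l))) (Prod.fst (Prod.snd (Prod.snd l))) (fun _ => (0 : ℝ))) : Matrix (Fin 3) (Fin 3) ℝ) = 1 ∨ (l.2.2.2 = none ∧ l.2.2.1 ≠ 0 ∧ (Matrix.transvection (Prod.fst l) (Prod.fst (Prod.snd l)) (Option.elim (Prod.snd (Prod.snd (Prod.snd l))) (Prod.fst (Prod.snd (Prod.snd l))) (fun _ => (0 : ℝ))) : Matrix (Fin 3) (Fin 3) ℝ) = Matrix.transvection l.1 l.2.1 l.2.2.1) := by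
  rcases l with ⟨i, j, c, _ | v⟩
  · by_cases hc : c = 0
    · left; simp [hc]
    · right; exact ⟨rfl, hc, by simp⟩
  · left; simp

end Summit.ValiantsHypothesis.ValiantsHypothesis.Cruxes.WordLengthQP.PositiveMonoidExits

end
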